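import Summits.QuantumAdvantage.QuantumAdvantage.Theses.OddPrimeWalk
import Summits.QuantumAdvantage.QuantumAdvantage.Theorems.WalkTwoStepDensePeelCriterion
import Summits.QuantumAdvantage.QuantumAdvantage.Theorems.WalkTwoStepFarLocal

/-!
# Route OddPrimeWalk, item `TwoStepFreeRungFive` (stmt-QuantumAdvantage-23121, support, rung (G♯)): genuine two-step selectors over `𝔽₅`

(G♯) local engine 5/5 (architecture in `WalkTwoStepDensePeelCylinder`).  THIS MODULE: §5b `part_bias_le` (selection of `k` usable
`ℓ`-separated positions with `effOn ≤ ℓ k + (ℓ − 1) + (2d₀ + 4p + 3) + #pinTimes`, three lifts, the criterion's residues, peeling, cylinder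
count), `densePinned_of_prime (p) (5 ≤ p) : DensePinned p` with `δ = 1 − 2^{−ℓ}/ℓ`, `K = δ⁻¹`, `C = (3/2) K^{(ℓ−1)+(2d₀+4p+3)}`,
`densePinned_five`, and the item's closing theorem `oddPrimeWalk_twoStepFreeRungFive : OddPrimeWalk.TwoStepFreeRungFive`
(= the tree's `twoStepFreeRungFive_of_densePinned` — `FarLocal 5`, `SparsePinned 5` already proved — applied to `densePinned_five`).
-/

namespace Summit.QuantumAdvantage.AdviceFreeQNC0.LocalEngine

open Finset Classical
open Summit.QuantumAdvantage.AdviceFreeQNC0.Coset21.RungG (classOf)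

namespace DensePeel

section Composition

variable {p n : ℕ}

/-- Per part: the bias is at most `(3/2)·2ⁿ·(1 − 2^{−ℓ})^k` with `ℓ·k + (ℓ − 1) + (2d₀ + 4p + 3) + #pinTimes ≥ effOn`. -/
theorem part_bias_le [Fact p.Prime] (hp5 : 5 ≤ p) (c d₀ : ℕ) (S : TwoStep p n) (w : ZMod p) (u₀ : Fin n → Bool) :
    ∃ k : ℕ, effOn c S (part S d₀ w u₀) ≤ ell p d₀ * k + (ell p d₀ - 1) + (2 * d₀ + 4 * p + 3) + (pinTimes S d₀).card ∧
      |((winPart c S d₀ w u₀).card : ℝ) - ((part S d₀ w u₀).card : ℝ) / 2|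
        ≤ 3 / 2 * (2 : ℝ) ^ n * (1 - (1 / 2 : ℝ) ^ (ell p d₀)) ^ k := by
  have hp1 : 1 ≤ p := by omega
  have hTus : ∀ τ ∈ ((univ : Finset (Fin (n + 1))).filter fun g => Usable c S d₀ w u₀ g.val).image Fin.val,
      Usable c S d₀ w u₀ τ := by
    intro τ hτ
    simp only [Finset.mem_image, Finset.mem_filter, Finset.mem_univ, true_and] at hτ
    obtain ⟨g, hg, rfl⟩ := hτ
    exact hg
  obtain ⟨P, hPT, hcard, hPsep⟩ := select (ell p d₀) (by unfold ell; omega)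
    (((univ : Finset (Fin (n + 1))).filter fun g => Usable c S d₀ w u₀ g.val).image Fin.val)
  refine ⟨P.card, ?_, ?_⟩
  · have := effOn_le_card_usable_add c d₀ S w u₀
    omega
  · obtain ⟨pos, hposmem, hsep⟩ : ∃ pos : Fin P.card → ℕ, (∀ i, pos i ∈ P) ∧
        ∀ i j : Fin P.card, i < j → pos i + ell p d₀ ≤ pos j :=
      ⟨fun i => P.orderEmbOfFin rfl i, fun i => Finset.orderEmbOfFin_mem P rfl i, fun i j hij =>
        hPsep _ (Finset.orderEmbOfFin_mem P rfl i) _ (Finset.orderEmbOfFin_mem P rfl j) ((P.orderEmbOfFin rfl).strictMono hij)⟩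
    have hus : ∀ i, Usable c S d₀ w u₀ (pos i) := fun i => hTus _ (hPT (hposmem i))
    -- per lift
    have hlift : ∀ w3 : ℕ,
        |(((((part S d₀ w u₀).filter fun u => wt u % 3 = w3).filter fun u => ringWinU c S.y u = true).card : ℝ))
          - ((((part S d₀ w u₀).filter fun u => wt u % 3 = w3).card : ℝ)) / 2|
          ≤ (2 : ℝ) ^ n * (1 - (1 / 2 : ℝ) ^ (ell p d₀)) ^ P.card / 2 := by
      intro w3
      have hcrit : ∀ i : Fin P.card, ∃ x : ℕ, x < 3 * p ∧ ∀ u ∈ part S d₀ w u₀, wt u % 3 = w3 → WinPat n d₀ (pos i) u →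
          wtPrefix u (pos i) % (3 * p) = x → ringWinU c S.y (cornerFlip n (pos i) u) ≠ ringWinU c S.y u :=
        fun i => criterion hp5 c d₀ S w u₀ (pos i) (hus i) w3
      choose x hxlt hxcrit using hcrit
      have h1 := lift_bias_le c d₀ S w u₀ w3 pos hsep hus x hxcrit
      have h2 := card_not_peelEvent_le (n := n) hp1 d₀ pos hsep (fun i => (hus i).1)
        (fun i => by have := (hus i).2.1; omega) x hxlt
      exact le_trans h1 (by linarith)
    -- sum over the three lifts
    have hmaps : ∀ u ∈ part S d₀ w u₀, wt u % 3 ∈ Finset.range 3 :=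
      fun u _ => Finset.mem_range.mpr (Nat.mod_lt _ (by norm_num))
    have cQ : ((part S d₀ w u₀).card : ℝ)
        = ∑ b ∈ Finset.range 3, (((part S d₀ w u₀).filter fun u => wt u % 3 = b).card : ℝ) := by
      exact_mod_cast Finset.card_eq_sum_card_fiberwise (f := fun u => wt u % 3) (s := part S d₀ w u₀)
        (t := Finset.range 3) (fun u hu => hmaps u hu)
    have cW : ((winPart c S d₀ w u₀).card : ℝ)
        = ∑ b ∈ Finset.range 3,
            ((((part S d₀ w u₀).filter fun u => wt u % 3 = b).filter fun u => ringWinU c S.y u = true).card : ℝ) := by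
      have h := Finset.card_eq_sum_card_fiberwise (f := fun u => wt u % 3) (s := winPart c S d₀ w u₀)
        (t := Finset.range 3) (fun u hu => by
          have hu' : u ∈ winPart c S d₀ w u₀ := hu
          unfold winPart at hu'
          exact hmaps u (Finset.mem_filter.mp hu').1)
      have e : ∀ b, ((winPart c S d₀ w u₀).filter fun u => wt u % 3 = b)
          = ((part S d₀ w u₀).filter fun u => wt u % 3 = b).filter fun u => ringWinU c S.y u = true := by
        intro b
        unfold winPart
        rw [Finset.filter_filter, Finset.filter_filter]
        exact Finset.filter_congr fun u _ => and_comm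
      rw [h]
      push_cast
      exact Finset.sum_congr rfl fun b _ => by rw [e]
    rw [cW, cQ, Finset.sum_div, ← Finset.sum_sub_distrib]
    refine le_trans (Finset.abs_sum_le_sum_abs _ _) ?_
    calc ∑ b ∈ Finset.range 3,
          |(((((part S d₀ w u₀).filter fun u => wt u % 3 = b).filter fun u => ringWinU c S.y u = true).card : ℝ))
            - ((((part S d₀ w u₀).filter fun u => wt u % 3 = b).card : ℝ)) / 2|
        ≤ ∑ b ∈ Finset.range 3, (2 : ℝ) ^ n * (1 - (1 / 2 : ℝ) ^ (ell p d₀)) ^ P.card / 2 :=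
          Finset.sum_le_sum fun b _ => hlift b
      _ = 3 / 2 * (2 : ℝ) ^ n * (1 - (1 / 2 : ℝ) ^ (ell p d₀)) ^ P.card := by
          rw [Finset.sum_const, Finset.card_range, nsmul_eq_mul]
          push_cast
          ring

/-- **`DensePinned p` for every prime `p ≥ 5`**, from the two stubs: `δ = 1 − 2^{−ℓ}/ℓ`, `K = δ⁻¹`, `C = (3/2)·K^{(ℓ−1)+(2d₀+4p+3)}`
with `ℓ = 3p + 2d₀ + 1`. -/
theorem densePinned_of_prime (p : ℕ) [Fact p.Prime] (hp5 : 5 ≤ p) : DensePinned p := by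
  intro d₀
  have hℓpos : 1 ≤ ell p d₀ := by unfold ell; omega
  have hℓ1 : (1 : ℝ) ≤ (ell p d₀ : ℝ) := by exact_mod_cast hℓpos
  have hℓ0 : (0 : ℝ) < (ell p d₀ : ℝ) := by linarith
  have hq0 : (0 : ℝ) < (1 / 2 : ℝ) ^ (ell p d₀) := by positivity
  have hq1 : (1 / 2 : ℝ) ^ (ell p d₀) ≤ 1 / 2 := by
    calc (1 / 2 : ℝ) ^ (ell p d₀) ≤ (1 / 2 : ℝ) ^ 1 := pow_le_pow_of_le_one (by norm_num) (by norm_num) hℓpos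
      _ = 1 / 2 := pow_one _
  obtain ⟨δ, hδ⟩ : ∃ δ : ℝ, δ = 1 - (1 / 2 : ℝ) ^ (ell p d₀) / (ell p d₀ : ℝ) := ⟨_, rfl⟩
  have hqℓ : (1 / 2 : ℝ) ^ (ell p d₀) / (ell p d₀ : ℝ) ≤ 1 / 2 := by
    rw [div_le_iff₀ hℓ0]; nlinarith
  have hqℓ0 : 0 < (1 / 2 : ℝ) ^ (ell p d₀) / (ell p d₀ : ℝ) := div_pos hq0 hℓ0
  have hδ0 : 0 < δ := by rw [hδ]; linarith
  have hδ1 : δ < 1 := by rw [hδ]; linarith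
  have hK1 : (1 : ℝ) ≤ δ⁻¹ := by rw [← one_div, le_div_iff₀ hδ0]; linarith
  obtain ⟨J, hJ⟩ : ∃ J : ℕ, J = (ell p d₀ - 1) + (2 * d₀ + 4 * p + 3) := ⟨_, rfl⟩
  refine ⟨δ, hδ0.le, hδ1, δ⁻¹, hK1, 3 / 2 * δ⁻¹ ^ J, by positivity, ?_⟩
  intro n c S w u₀
  obtain ⟨k, hk, hbias⟩ := part_bias_le hp5 c d₀ S w u₀
  -- Bernoulli: `1 − q ≤ δ^ℓ`
  have hB : 1 - (1 / 2 : ℝ) ^ (ell p d₀) ≤ δ ^ (ell p d₀) := by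
    have h := one_add_mul_le_pow (a := -((1 / 2 : ℝ) ^ (ell p d₀) / (ell p d₀ : ℝ))) (by linarith) (ell p d₀)
    have e1 : (1 : ℝ) + (ell p d₀ : ℝ) * (-((1 / 2 : ℝ) ^ (ell p d₀) / (ell p d₀ : ℝ))) = 1 - (1 / 2 : ℝ) ^ (ell p d₀) := by
      field_simp
      ring
    have e2 : (1 : ℝ) + (-((1 / 2 : ℝ) ^ (ell p d₀) / (ell p d₀ : ℝ))) = δ := by rw [hδ]; ring
    rw [e1, e2] at h
    exact h
  have h1q : 0 ≤ 1 - (1 / 2 : ℝ) ^ (ell p d₀) := by linarith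
  have hpow : (1 - (1 / 2 : ℝ) ^ (ell p d₀)) ^ k ≤ δ ^ (ell p d₀ * k) := by
    rw [pow_mul]
    exact pow_le_pow_left₀ h1q hB k
  have hexp : effOn c S (part S d₀ w u₀) ≤ ell p d₀ * k + J + (pinTimes S d₀).card := by rw [hJ]; omega
  have hmono : δ ^ (ell p d₀ * k + J + (pinTimes S d₀).card) ≤ δ ^ (effOn c S (part S d₀ w u₀)) :=
    pow_le_pow_of_le_one hδ0.le hδ1.le hexp
  have hkey : δ ^ (ell p d₀ * k) ≤ δ ^ (effOn c S (part S d₀ w u₀)) * δ⁻¹ ^ J * δ⁻¹ ^ ((pinTimes S d₀).card) := by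
    have eJ : δ⁻¹ ^ J * δ ^ J = 1 := by rw [← mul_pow, inv_mul_cancel₀ hδ0.ne', one_pow]
    have eπ : δ⁻¹ ^ ((pinTimes S d₀).card) * δ ^ ((pinTimes S d₀).card) = 1 := by
      rw [← mul_pow, inv_mul_cancel₀ hδ0.ne', one_pow]
    have hprod : δ ^ (ell p d₀ * k) * δ ^ J * δ ^ ((pinTimes S d₀).card) ≤ δ ^ (effOn c S (part S d₀ w u₀)) := by
      rw [← pow_add, ← pow_add]; exact hmono
    have hnn : (0 : ℝ) ≤ δ⁻¹ ^ J * δ⁻¹ ^ ((pinTimes S d₀).card) := by positivity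
    calc δ ^ (ell p d₀ * k)
        = δ ^ (ell p d₀ * k) * (δ⁻¹ ^ J * δ ^ J) * (δ⁻¹ ^ ((pinTimes S d₀).card) * δ ^ ((pinTimes S d₀).card)) := by
          rw [eJ, eπ, mul_one, mul_one]
      _ = (δ ^ (ell p d₀ * k) * δ ^ J * δ ^ ((pinTimes S d₀).card)) * (δ⁻¹ ^ J * δ⁻¹ ^ ((pinTimes S d₀).card)) := by
          ring
      _ ≤ δ ^ (effOn c S (part S d₀ w u₀)) * (δ⁻¹ ^ J * δ⁻¹ ^ ((pinTimes S d₀).card)) :=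
          mul_le_mul_of_nonneg_right hprod hnn
      _ = δ ^ (effOn c S (part S d₀ w u₀)) * δ⁻¹ ^ J * δ⁻¹ ^ ((pinTimes S d₀).card) := by ring
  have h2n : (0 : ℝ) ≤ 3 / 2 * (2 : ℝ) ^ n := by positivity
  calc |((winPart c S d₀ w u₀).card : ℝ) - ((part S d₀ w u₀).card : ℝ) / 2|
      ≤ 3 / 2 * (2 : ℝ) ^ n * (1 - (1 / 2 : ℝ) ^ (ell p d₀)) ^ k := hbias
    _ ≤ 3 / 2 * (2 : ℝ) ^ n * (δ ^ (effOn c S (part S d₀ w u₀)) * δ⁻¹ ^ J * δ⁻¹ ^ ((pinTimes S d₀).card)) :=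
        mul_le_mul_of_nonneg_left (le_trans hpow hkey) h2n
    _ = 3 / 2 * δ⁻¹ ^ J * (2 : ℝ) ^ n * δ ^ (effOn c S (part S d₀ w u₀)) * δ⁻¹ ^ ((pinTimes S d₀).card) := by ring

/-- **`DensePinned 5`** (the last open hypothesis of `twoStepFreeRungFive_of_densePinned`, item stmt-QuantumAdvantage-23121). -/
theorem densePinned_five : DensePinned 5 :=
  haveI : Fact (Nat.Prime 5) := ⟨by norm_num⟩
  densePinned_of_prime 5 le_rfl

end Composition

end DensePeel

end Summit.QuantumAdvantage.AdviceFreeQNC0.LocalEngine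

namespace Summit.QuantumAdvantage.QuantumAdvantage.Theorems

set_option linter.dupNamespace false

/-- **Item stmt-QuantumAdvantage-23121** (route `OddPrimeWalk`, support, rung (G♯)): `TwoStepFreeRungFive` holds — genuine
two-step linear selectors over `𝔽₅` (cut `g` fires iff `α_g N(s_g) + β_g (wt − N(s_g)) = r_g`, positions and splits arbitrary)
win the u-walk game `ringWinU c` on at most `θ·2ⁿ` inputs for `n ≥ n₀`, one `θ < 1`.  Assembly of the tree's
`FarLocal 5`, `SparsePinned 5` (`twoStepFreeRungFive_of_densePinned`) with `DensePeel.densePinned_five`. -/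
theorem oddPrimeWalk_twoStepFreeRungFive :
    Summit.QuantumAdvantage.QuantumAdvantage.Theses.OddPrimeWalk.TwoStepFreeRungFive :=
  Summit.QuantumAdvantage.AdviceFreeQNC0.LocalEngine.twoStepFreeRungFive_of_densePinned
    Summit.QuantumAdvantage.AdviceFreeQNC0.LocalEngine.DensePeel.densePinned_five

end Summit.QuantumAdvantage.QuantumAdvantage.Theorems
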